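import Mathlib
import HarnessLib
import Summits.Ventures.LatticeQCDFlow.Exactness.NCMCGeneralSpaceOverlap

/-!
# Bennett's acceptance-ratio equation on a general state space: the population root is `ΔF`, uniquely

HONEST FRAMING: exact (Metropolis-corrected) sampling algorithms for lattice gauge theory;
figures of merit are autocorrelation/cost numbers at stated couplings and volumes; no
continuum-physics claim.

Venture `LatticeQCDFlow` (cell pub-lqcd), topic `Exactness`; FANOUT row 13 (`eng-snf`, GEN-11).
NEW WORK of the cell (general measure theory, elementary), not a published result; nothing is
cited as a fact (C. H. Bennett, J. Comput. Phys. 22 (1976) 245; M. R. Shirts, E. Bair, G. Hooker,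
V. S. Pande, Phys. Rev. Lett. 91 (2003) 140601 named only).  General-state-space counterpart of the
population half of row 13's finite `Exactness/BennettAcceptanceRatio.lean` (`bennett_population`,
`barFn_strictMono`, `barFn_existsUnique_root` — the SAMPLE equation); built on
`NCMCGeneralSpaceAcceptance.bennett_identity` (un-normalised, every `c`) and the setting of
`NCMCGeneralSpaceOverlap.lean`: a Crooks pair from `ν₀` to `ν₁`, `P_F = fwdPathLaw ν₀ κF`,
`P_R = fwdPathLaw ν₁ κR`, `e^{−ΔF} = Z₁/Z₀`, Fermi function `σ = Real.sigmoid`.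

WHY.  `snf.estimators.bar` and `ncmc.c_from_works` solve the two-sample Bennett equation
`mean_F σ(c − W) = mean_R σ(W − c)` for `c` by a bracketing root search.  This file says what that
equation is in population, for EVERY protocol certified as a Crooks pair on the engine's state space:
its two sides differ by the factor `e^{c−ΔF}`, so the root is `ΔF` and no other number, and the gap
is strictly increasing in `c` (bracketing is safe).

## Content

* `CrooksPair.lintegral_sigmoid_fwdPathLaw`, **`CrooksPair.integral_sigmoid_fwd_eq`** — NORMALISED
  BENNETT IDENTITY: `E_{P_F}[σ(c − W)] = e^{c−ΔF} · E_{P_R}[σ(W − c)]` for every `c`.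
* `CrooksPair.integral_sigmoid_rev_pos` — the reverse Fermi rate is positive;
  **`CrooksPair.integral_sigmoid_fwd_eq_rev_iff`** — THE POPULATION BAR EQUATION HOLDS IFF `c = ΔF`;
  `CrooksPair.integral_sigmoid_fwd_lt_rev_iff` / `_rev_lt_fwd_iff` — below the root the forward
  Fermi rate is the smaller one, above it the larger (the sign a bracketing search reads).
* `strictMono_integral_sigmoid_sub` — the gap `c ↦ E_{P_F}[σ(c − W)] − E_{P_R}[σ(W − c)]` is
  strictly increasing (each lane separately monotone: `integral_sigmoid_fwd_strictMono`,
  `integral_sigmoid_rev_strictAnti`), for ANY two probability laws — no Crooks pair needed.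
* `CrooksPair.half_accept_le_integral_sigmoid` / `integral_sigmoid_le_accept` — at the root the
  common Fermi rate (Bennett's overlap) sits between half the Metropolis switch acceptance
  `acc(ΔF) = E_{P_F}[min(1, e^{−(W−ΔF)})]` of `NCMCGeneralSpaceOverlap.lean` and `acc(ΔF)` itself
  (pointwise `½ min(1, e^{x}) ≤ σ(x) ≤ min(1, e^{x})`).

Nothing is claimed about the SAMPLE equation's root (finite file) beyond what consistency gives, nor
about the variance of the BAR estimate.
-/

namespace Summit.Ventures.LatticeQCDFlow.Exactness.GeneralNCMC

open MeasureTheory ProbabilityTheory Set Filter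
open scoped ENNReal

variable {Ω E : Type*} [MeasurableSpace Ω] [MeasurableSpace E]

/-! ## Monotonicity of the two Fermi rates in `c` (any laws) -/

/-- The Fermi integrand is integrable under a probability law (bounded by one). -/
theorem integrable_sigmoid_comp {μ : Measure E} [IsProbabilityMeasure μ] {g : E → ℝ}
    (hg : Measurable g) : Integrable (fun ε => Real.sigmoid (g ε)) μ := by
  refine (integrable_const (1 : ℝ)).mono'
    (_root_.continuous_sigmoid.measurable.comp hg).aestronglyMeasurable
    (Eventually.of_forall fun ε => ?_)
  rw [Real.norm_eq_abs, abs_of_pos (Real.sigmoid_pos _)]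
  exact Real.sigmoid_le_one _

/-- The forward Fermi rate `c ↦ E_μ[σ(c − W)]` is strictly increasing (probability law `μ`). -/
theorem integral_sigmoid_fwd_strictMono (μ : Measure E) [IsProbabilityMeasure μ] {W : E → ℝ}
    (hW : Measurable W) : StrictMono fun c => ∫ ε, Real.sigmoid (c - W ε) ∂μ := by
  intro c c' hcc'
  have hi : Integrable (fun ε => Real.sigmoid (c - W ε)) μ :=
    integrable_sigmoid_comp (measurable_const.sub hW)
  have hi' : Integrable (fun ε => Real.sigmoid (c' - W ε)) μ :=
    integrable_sigmoid_comp (measurable_const.sub hW)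
  have hsub : Integrable (fun ε => Real.sigmoid (c' - W ε) - Real.sigmoid (c - W ε)) μ := hi'.sub hi
  have hpos : 0 < ∫ ε, (Real.sigmoid (c' - W ε) - Real.sigmoid (c - W ε)) ∂μ := by
    rw [integral_pos_iff_support_of_nonneg (fun ε => ?_) hsub]
    · have hsupp : Function.support (fun ε => Real.sigmoid (c' - W ε) - Real.sigmoid (c - W ε)) =
          univ := by
        ext ε
        simp only [Function.mem_support, mem_univ, iff_true]
        exact (sub_pos.2 (Real.sigmoid_lt (by linarith))).ne'
      rw [hsupp, measure_univ]
      exact one_pos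
    · exact sub_nonneg.2 (Real.sigmoid_le (by linarith))
  rw [integral_sub hi' hi] at hpos
  simpa only [sub_pos] using hpos

/-- The reverse Fermi rate `c ↦ E_μ[σ(W − c)]` is strictly decreasing. -/
theorem integral_sigmoid_rev_strictAnti (μ : Measure E) [IsProbabilityMeasure μ] {W : E → ℝ}
    (hW : Measurable W) : StrictAnti fun c => ∫ ε, Real.sigmoid (W ε - c) ∂μ := by
  intro c c' hcc'
  have hi : Integrable (fun ε => Real.sigmoid (W ε - c)) μ :=
    integrable_sigmoid_comp (hW.sub measurable_const)
  have hi' : Integrable (fun ε => Real.sigmoid (W ε - c')) μ :=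
    integrable_sigmoid_comp (hW.sub measurable_const)
  have hsub : Integrable (fun ε => Real.sigmoid (W ε - c) - Real.sigmoid (W ε - c')) μ := hi.sub hi'
  have hpos : 0 < ∫ ε, (Real.sigmoid (W ε - c) - Real.sigmoid (W ε - c')) ∂μ := by
    rw [integral_pos_iff_support_of_nonneg (fun ε => ?_) hsub]
    · have hsupp : Function.support (fun ε => Real.sigmoid (W ε - c) - Real.sigmoid (W ε - c')) =
          univ := by
        ext ε
        simp only [Function.mem_support, mem_univ, iff_true]
        exact (sub_pos.2 (Real.sigmoid_lt (by linarith))).ne'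
      rw [hsupp, measure_univ]
      exact one_pos
    · exact sub_nonneg.2 (Real.sigmoid_le (by linarith))
  rw [integral_sub hi hi'] at hpos
  simpa only [sub_pos] using hpos

/-- **The Bennett gap is strictly increasing in `c`**: for any two probability laws `μF, μR` on
records, `c ↦ E_{μF}[σ(c − W)] − E_{μR}[σ(W − c)]` is strictly increasing — so it has at most one
root and a bracketing search cannot be fooled (population form of the finite `barFn_strictMono`). -/
theorem strictMono_integral_sigmoid_sub (μF μR : Measure E) [IsProbabilityMeasure μF]
    [IsProbabilityMeasure μR] {W : E → ℝ} (hW : Measurable W) :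
    StrictMono fun c => ∫ ε, Real.sigmoid (c - W ε) ∂μF - ∫ ε, Real.sigmoid (W ε - c) ∂μR :=
  fun _ _ hcc' => sub_lt_sub (integral_sigmoid_fwd_strictMono μF hW hcc')
    (integral_sigmoid_rev_strictAnti μR hW hcc')

namespace CrooksPair

variable {ν₀ ν₁ : Measure Ω} {κF κR : Kernel Ω E} {s e : E → Ω} {W : E → ℝ}

/-! ## The normalised Bennett identity -/

/-- **Normalised Bennett identity** (`ℝ≥0∞` form): for every `c`,
`∫ σ(c − W) dP_F = e^{c−ΔF} ∫ σ(W − c) dP_R`. -/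
theorem lintegral_sigmoid_fwdPathLaw [IsFiniteMeasure ν₀] [IsFiniteMeasure ν₁] (h0 : ν₀ univ ≠ 0)
    (h1 : ν₁ univ ≠ 0) (h : CrooksPair ν₀ ν₁ κF κR s e W) {ΔF : ℝ}
    (hΔF : Real.exp (-ΔF) = ((ν₀ univ)⁻¹ * ν₁ univ).toReal) (c : ℝ) :
    ∫⁻ ε, ENNReal.ofReal (Real.sigmoid (c - W ε)) ∂(fwdPathLaw ν₀ κF) =
      ENNReal.ofReal (Real.exp (c - ΔF)) *
        ∫⁻ ε, ENNReal.ofReal (Real.sigmoid (W ε - c)) ∂(fwdPathLaw ν₁ κR) := by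
  have hr0 : (ν₀ univ)⁻¹ * ν₁ univ ≠ ⊤ :=
    ENNReal.mul_ne_top (ENNReal.inv_ne_top.2 h0) (measure_ne_top ν₁ univ)
  have hΔ : ENNReal.ofReal (Real.exp (-ΔF)) = (ν₀ univ)⁻¹ * ν₁ univ := by
    rw [hΔF, ENNReal.ofReal_toReal hr0]
  rw [fwdPathLaw, fwdPathLaw, lintegral_smul_measure, lintegral_smul_measure, h.bennett_identity c,
    smul_eq_mul, smul_eq_mul, sub_eq_add_neg, Real.exp_add, ENNReal.ofReal_mul (Real.exp_pos c).le, hΔ]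
  rw [show ENNReal.ofReal (Real.exp c) * ((ν₀ univ)⁻¹ * ν₁ univ) *
        ((ν₁ univ)⁻¹ * ∫⁻ ε, ENNReal.ofReal (Real.sigmoid (W ε - c)) ∂(ν₁.bind κR)) =
      (ν₀ univ)⁻¹ * (ENNReal.ofReal (Real.exp c) *
        ∫⁻ ε, ENNReal.ofReal (Real.sigmoid (W ε - c)) ∂(ν₁.bind κR)) * (ν₁ univ * (ν₁ univ)⁻¹) by ring,
    ENNReal.mul_inv_cancel h1 (measure_ne_top ν₁ univ), mul_one]

/-- **Normalised Bennett identity** (real form): for every `c`,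
`E_{P_F}[σ(c − W)] = e^{c−ΔF} · E_{P_R}[σ(W − c)]`. -/
theorem integral_sigmoid_fwd_eq [IsFiniteMeasure ν₀] [IsFiniteMeasure ν₁] [IsMarkovKernel κF]
    [IsMarkovKernel κR] (h0 : ν₀ univ ≠ 0) (h1 : ν₁ univ ≠ 0) (h : CrooksPair ν₀ ν₁ κF κR s e W)
    {ΔF : ℝ} (hΔF : Real.exp (-ΔF) = ((ν₀ univ)⁻¹ * ν₁ univ).toReal) (c : ℝ) :
    ∫ ε, Real.sigmoid (c - W ε) ∂(fwdPathLaw ν₀ κF) =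
      Real.exp (c - ΔF) * ∫ ε, Real.sigmoid (W ε - c) ∂(fwdPathLaw ν₁ κR) := by
  have hmF : Measurable fun ε => Real.sigmoid (c - W ε) :=
    _root_.continuous_sigmoid.measurable.comp (measurable_const.sub h.measurable_W)
  have hmR : Measurable fun ε => Real.sigmoid (W ε - c) :=
    _root_.continuous_sigmoid.measurable.comp (h.measurable_W.sub measurable_const)
  rw [integral_eq_lintegral_of_nonneg_ae (Eventually.of_forall fun ε => Real.sigmoid_nonneg _)
      hmF.aestronglyMeasurable,
    integral_eq_lintegral_of_nonneg_ae (Eventually.of_forall fun ε => Real.sigmoid_nonneg _)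
      hmR.aestronglyMeasurable,
    h.lintegral_sigmoid_fwdPathLaw h0 h1 hΔF c, ENNReal.toReal_mul,
    ENNReal.toReal_ofReal (Real.exp_pos _).le]

/-- The reverse Fermi rate is positive: `0 < E_{P_R}[σ(W − c)]`. -/
theorem integral_sigmoid_rev_pos [IsFiniteMeasure ν₁] [IsMarkovKernel κR] (h1 : ν₁ univ ≠ 0)
    (h : CrooksPair ν₀ ν₁ κF κR s e W) (c : ℝ) :
    0 < ∫ ε, Real.sigmoid (W ε - c) ∂(fwdPathLaw ν₁ κR) := by
  haveI := isProbabilityMeasure_fwdPathLaw ν₁ h1 κR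
  have hi : Integrable (fun ε => Real.sigmoid (W ε - c)) (fwdPathLaw ν₁ κR) :=
    integrable_sigmoid_comp (h.measurable_W.sub measurable_const)
  rw [integral_pos_iff_support_of_nonneg (fun ε => Real.sigmoid_nonneg _) hi]
  have hsupp : Function.support (fun ε => Real.sigmoid (W ε - c)) = univ := by
    ext ε
    simp only [Function.mem_support, mem_univ, iff_true]
    exact (Real.sigmoid_pos _).ne'
  rw [hsupp, measure_univ]
  exact one_pos

/-! ## The root -/

/-- **The population Bennett equation holds iff `c = ΔF`.**  For every Crooks pair on a general
measurable state space: `E_{P_F}[σ(c − W)] = E_{P_R}[σ(W − c)] ↔ c = ΔF` — the number the engine's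
BAR root search estimates is the free-energy difference, for adjoint stochastic steps,
Jacobian-charged layers and their concatenations alike. -/
theorem integral_sigmoid_fwd_eq_rev_iff [IsFiniteMeasure ν₀] [IsFiniteMeasure ν₁] [IsMarkovKernel κF]
    [IsMarkovKernel κR] (h0 : ν₀ univ ≠ 0) (h1 : ν₁ univ ≠ 0) (h : CrooksPair ν₀ ν₁ κF κR s e W)
    {ΔF : ℝ} (hΔF : Real.exp (-ΔF) = ((ν₀ univ)⁻¹ * ν₁ univ).toReal) (c : ℝ) :
    ∫ ε, Real.sigmoid (c - W ε) ∂(fwdPathLaw ν₀ κF) = ∫ ε, Real.sigmoid (W ε - c) ∂(fwdPathLaw ν₁ κR) ↔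
      c = ΔF := by
  have hR := h.integral_sigmoid_rev_pos h1 c
  rw [h.integral_sigmoid_fwd_eq h0 h1 hΔF c]
  constructor
  · intro heq
    have hone : Real.exp (c - ΔF) = 1 := by
      have := mul_right_cancel₀ hR.ne' (heq.trans (one_mul _).symm)
      exact this
    rw [Real.exp_eq_one_iff, sub_eq_zero] at hone
    exact hone
  · rintro rfl
    rw [sub_self, Real.exp_zero, one_mul]

/-- **Below the root the forward Fermi rate is the smaller one**:
`E_{P_F}[σ(c − W)] < E_{P_R}[σ(W − c)] ↔ c < ΔF`. -/
theorem integral_sigmoid_fwd_lt_rev_iff [IsFiniteMeasure ν₀] [IsFiniteMeasure ν₁] [IsMarkovKernel κF]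
    [IsMarkovKernel κR] (h0 : ν₀ univ ≠ 0) (h1 : ν₁ univ ≠ 0) (h : CrooksPair ν₀ ν₁ κF κR s e W)
    {ΔF : ℝ} (hΔF : Real.exp (-ΔF) = ((ν₀ univ)⁻¹ * ν₁ univ).toReal) (c : ℝ) :
    ∫ ε, Real.sigmoid (c - W ε) ∂(fwdPathLaw ν₀ κF) < ∫ ε, Real.sigmoid (W ε - c) ∂(fwdPathLaw ν₁ κR) ↔
      c < ΔF := by
  have hR := h.integral_sigmoid_rev_pos h1 c
  rw [h.integral_sigmoid_fwd_eq h0 h1 hΔF c, mul_lt_iff_lt_one_left hR, Real.exp_lt_one_iff, sub_neg]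

/-- **Above the root the forward Fermi rate is the larger one**:
`E_{P_R}[σ(W − c)] < E_{P_F}[σ(c − W)] ↔ ΔF < c`. -/
theorem integral_sigmoid_rev_lt_fwd_iff [IsFiniteMeasure ν₀] [IsFiniteMeasure ν₁] [IsMarkovKernel κF]
    [IsMarkovKernel κR] (h0 : ν₀ univ ≠ 0) (h1 : ν₁ univ ≠ 0) (h : CrooksPair ν₀ ν₁ κF κR s e W)
    {ΔF : ℝ} (hΔF : Real.exp (-ΔF) = ((ν₀ univ)⁻¹ * ν₁ univ).toReal) (c : ℝ) :
    ∫ ε, Real.sigmoid (W ε - c) ∂(fwdPathLaw ν₁ κR) < ∫ ε, Real.sigmoid (c - W ε) ∂(fwdPathLaw ν₀ κF) ↔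
      ΔF < c := by
  have hR := h.integral_sigmoid_rev_pos h1 c
  rw [h.integral_sigmoid_fwd_eq h0 h1 hΔF c, lt_mul_iff_one_lt_left hR, Real.one_lt_exp_iff, sub_pos]

/-! ## Bennett's overlap against the Metropolis switch acceptance -/

omit [MeasurableSpace E] in
/-- Pointwise: `½ min(1, e^{x}) ≤ σ(x) ≤ min(1, e^{x})` with `x = −(W − ΔF)`. -/
theorem half_min_le_sigmoid_le_min (x : ℝ) :
    (1 / 2) * min 1 (Real.exp x) ≤ Real.sigmoid x ∧ Real.sigmoid x ≤ min 1 (Real.exp x) := by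
  have hσ : Real.sigmoid x = Real.exp x / (Real.exp x + 1) := by
    rw [Real.sigmoid_def, Real.exp_neg]
    have hpos := Real.exp_pos x
    field_simp
  have hpos := Real.exp_pos x
  rw [hσ]
  constructor
  · rcases le_total 1 (Real.exp x) with hle | hle
    · rw [min_eq_left hle, mul_one, div_le_div_iff₀ two_pos (by linarith), one_mul]
      linarith
    · rw [min_eq_right hle, le_div_iff₀ (by linarith)]
      nlinarith
  · rcases le_total 1 (Real.exp x) with hle | hle
    · rw [min_eq_left hle, div_le_one (by linarith)]
      linarith
    · rw [min_eq_right hle, div_le_iff₀ (by linarith)]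
      nlinarith

/-- **Bennett's overlap is at least half the switch acceptance**:
`½ · acc(ΔF) ≤ E_{P_F}[σ(ΔF − W)]`. -/
theorem half_accept_le_integral_sigmoid [IsFiniteMeasure ν₀] [IsMarkovKernel κF] (h0 : ν₀ univ ≠ 0)
    (h : CrooksPair ν₀ ν₁ κF κR s e W) (ΔF : ℝ) :
    (1 / 2) * ∫ ε, min 1 (Real.exp (-(W ε - ΔF))) ∂(fwdPathLaw ν₀ κF) ≤
      ∫ ε, Real.sigmoid (ΔF - W ε) ∂(fwdPathLaw ν₀ κF) := by
  haveI := isProbabilityMeasure_fwdPathLaw ν₀ h0 κF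
  rw [← integral_const_mul]
  refine integral_mono ((h.integrable_accept h0 ΔF).const_mul _)
    (integrable_sigmoid_comp (measurable_const.sub h.measurable_W)) fun ε => ?_
  dsimp only
  rw [show -(W ε - ΔF) = ΔF - W ε by ring]
  exact (half_min_le_sigmoid_le_min (ΔF - W ε)).1

/-- **… and at most the switch acceptance**: `E_{P_F}[σ(ΔF − W)] ≤ acc(ΔF)`. -/
theorem integral_sigmoid_le_accept [IsFiniteMeasure ν₀] [IsMarkovKernel κF] (h0 : ν₀ univ ≠ 0)
    (h : CrooksPair ν₀ ν₁ κF κR s e W) (ΔF : ℝ) :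
    ∫ ε, Real.sigmoid (ΔF - W ε) ∂(fwdPathLaw ν₀ κF) ≤
      ∫ ε, min 1 (Real.exp (-(W ε - ΔF))) ∂(fwdPathLaw ν₀ κF) := by
  haveI := isProbabilityMeasure_fwdPathLaw ν₀ h0 κF
  refine integral_mono (integrable_sigmoid_comp (measurable_const.sub h.measurable_W))
    (h.integrable_accept h0 ΔF) fun ε => ?_
  dsimp only
  rw [show -(W ε - ΔF) = ΔF - W ε by ring]
  exact (half_min_le_sigmoid_le_min (ΔF - W ε)).2

end CrooksPair

end Summit.Ventures.LatticeQCDFlow.Exactness.GeneralNCMC
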